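import Mathlib.Analysis.SpecialFunctions.Log.NegMulLog
import Mathlib.Analysis.Calculus.Deriv.MeanValue
import Mathlib.Algebra.BigOperators.Ring.Finset
import Mathlib.Algebra.BigOperators.Field
import Mathlib.Data.Fintype.BigOperators
import HarnessLib

/-!
# The pseudo-random behaviour of large subsets of a product (Rothvoß 2017, Lemma 10)

Support file for the discharge of `Literature.Barriers.PneNP.Rothvoss2017_tsp`. Rothvoß's
Lemma 10 (after Razborov): "Take finite sets `X₁, …, X_m` with `1 ≤ |X_i| ≤ q` and
`X := X₁ × … × X_m`. Let `Y ⊆ X` with `|Y| ≥ 2^{-δm}|X|`. An index `i` is `ε`-unbiased if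
`(1/(1+ε))·(1/|X_i|) ≤ Pr_{y ∼ Y}[y_i = j] ≤ (1+ε)·(1/|X_i|)` for all `j ∈ X_i`. Then at most `εm`
indices are `ε`-biased" (for a constant `δ = δ(ε,q) > 0`). We prove its QUANTITATIVE CORE with an
explicit constant, from which every such threshold statement follows by arithmetic:

* `card_biased_mul_le_log` — for any set `B` of `ε`-biased indices,
  `|B| · c ≤ log |X| - log |Y|` with `c = (ε / ((1+ε) q))² / 2` (natural logarithms).

The printed proof is followed: `log |Y| = H(y) ≤ Σ_i H(y_i)` for `y` uniform on `Y`
(sub-additivity of entropy — here in the elementary form `Σ_{y ∈ Y} log(|Y| Π_i p_i(y_i)) ≤ 0`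
from `log z ≤ z - 1` and `Σ_{y ∈ X} Π_i p_i(y_i) = 1`), and `H(y_i) ≤ log |X_i| - c` for a biased
coordinate; the paper gets SOME `c > 0` "for compactness reasons", we use the explicit strong
convexity of `x log x` on `[0,1]` (`mul_log_lower_quadratic`:
`x log x ≥ u log u + (1 + log u)(x - u) + (x - u)²/2`), giving
`log |X_i| - H(p) ≥ ½ ‖p - uniform‖₂² ≥ ½ (ε / ((1+ε)|X_i|))²`.

Sources: [Rothvoss2017] Lemma 10 and its proof (PDF pp. 10–11).
-/

noncomputable section

namespace Literature.Barriers.PneNP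

open Finset Real

/-! ### Strong convexity of `x log x` on `[0,1]` -/

/-- **Strong convexity of `x ↦ x log x` on `[0,1]`** (modulus `1`, since `(x log x)'' = 1/x ≥ 1`
there): `x log x ≥ u log u + (1 + log u)(x - u) + (x - u)²/2` for `x ∈ [0,1]`, `u ∈ (0,1]`.
Proof: the difference has derivative `log x - log u - (x - u)`, which is `≥ 0` on `[u,1]` and
`≤ 0` on `(0,u]` by `1 - 1/z ≤ log z`. [folklore] -/
theorem mul_log_lower_quadratic {x u : ℝ} (hx0 : 0 ≤ x) (hx1 : x ≤ 1) (hu0 : 0 < u)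
    (hu1 : u ≤ 1) :
    u * log u + (1 + log u) * (x - u) + (x - u) ^ 2 / 2 ≤ x * log x := by
  set g : ℝ → ℝ := fun y =>
    y * log y - (u * log u + (1 + log u) * (y - u) + (y - u) ^ 2 / 2) with hg
  have hgu : g u = 0 := by simp [hg]
  have hderiv : ∀ y, y ≠ 0 → HasDerivAt g (log y - log u - (y - u)) y := by
    intro y hy
    have h1 : HasDerivAt (fun x => x * log x) (log y + 1) y := hasDerivAt_mul_log hy
    have h2 : HasDerivAt (fun x : ℝ => x ^ 2) (((2 : ℕ) : ℝ) * y ^ (2 - 1)) y := hasDerivAt_pow 2 y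
    have h3 : HasDerivAt (fun x : ℝ => x) 1 y := hasDerivAt_id' y
    have h4 := h1.sub ((h2.div_const 2).add (h3.const_mul (1 + log u - u)))
    have h5 := h4.sub_const (u * log u - (1 + log u) * u + u ^ 2 / 2)
    refine (h5.congr_of_eventuallyEq (Filter.Eventually.of_forall fun z => ?_)).congr_deriv ?_
    · simp only [hg, Pi.sub_apply, Pi.add_apply]
      ring
    · have e : ((2 : ℕ) : ℝ) * y ^ (2 - 1) / 2 = y := by norm_num
      rw [e]
      ring
  have hcont : ContinuousOn g (Set.Icc 0 1) := by
    have : Continuous g := by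
      simp only [hg]
      exact continuous_mul_log.sub (by fun_prop)
    exact this.continuousOn
  have hmono : MonotoneOn g (Set.Icc u 1) := by
    refine monotoneOn_of_deriv_nonneg (convex_Icc u 1)
      (hcont.mono (Set.Icc_subset_Icc hu0.le le_rfl)) (fun y hy => ?_) (fun y hy => ?_)
    · rw [interior_Icc] at hy
      exact (hderiv y (by linarith [hy.1])).differentiableAt.differentiableWithinAt
    · rw [interior_Icc] at hy
      have hy0 : 0 < y := by linarith [hy.1]
      rw [(hderiv y hy0.ne').deriv]
      have h2 : 1 - (y / u)⁻¹ ≤ log (y / u) := one_sub_inv_le_log_of_pos (by positivity)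
      rw [log_div hy0.ne' hu0.ne', inv_div] at h2
      have h3 : y - u ≤ 1 - u / y := by
        rw [show 1 - u / y = (y - u) / y by field_simp]
        exact le_div_self (by linarith [hy.1]) hy0 hy.2.le
      linarith
  have hanti : AntitoneOn g (Set.Icc 0 u) := by
    refine antitoneOn_of_deriv_nonpos (convex_Icc 0 u)
      (hcont.mono (Set.Icc_subset_Icc le_rfl hu1)) (fun y hy => ?_) (fun y hy => ?_)
    · rw [interior_Icc] at hy
      exact (hderiv y hy.1.ne').differentiableAt.differentiableWithinAt
    · rw [interior_Icc] at hy
      rw [(hderiv y hy.1.ne').deriv]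
      have h2 : 1 - (u / y)⁻¹ ≤ log (u / y) := one_sub_inv_le_log_of_pos (div_pos hu0 hy.1)
      rw [log_div hu0.ne' hy.1.ne', inv_div] at h2
      have h3 : u - y ≤ 1 - y / u := by
        rw [show 1 - y / u = (u - y) / u by field_simp]
        exact le_div_self (by linarith [hy.2]) hu0 hu1
      linarith
  have hxg : 0 ≤ g x := by
    rcases le_total u x with hux | hxu
    · have := hmono ⟨le_rfl, hu1⟩ ⟨hux, hx1⟩ hux
      rwa [hgu] at this
    · have := hanti ⟨hx0, hxu⟩ ⟨hu0.le, le_rfl⟩ hxu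
      rwa [hgu] at this
  simp only [hg] at hxg
  linarith

/-- **Entropy deficit of a distribution is at least half its squared distance from uniform, at
any single atom**: for a probability vector `p` on a finite set `s`,
`-Σ p_j log p_j ≤ log |s| - (p_{j₀} - 1/|s|)² / 2` (sum `mul_log_lower_quadratic` with
`u = 1/|s|`; the linear terms cancel). This is the explicit form of "the inequality
`H(y_i) ≤ log₂ |X_i|` is tight only for the uniform distribution ... hence for compactness
reasons there has to be a constant `c`". [cite: Rothvoss2017, proof of Lemma 10 (PDF p. 10)] -/
theorem neg_sum_mul_log_le {β : Type*} {s : Finset β} (hs : s.Nonempty) (p : β → ℝ)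
    (hp0 : ∀ j ∈ s, 0 ≤ p j) (hsum : ∑ j ∈ s, p j = 1) {j₀ : β} (hj₀ : j₀ ∈ s) :
    -∑ j ∈ s, p j * log (p j) ≤ log s.card - (p j₀ - 1 / s.card) ^ 2 / 2 := by
  set q' : ℝ := (s.card : ℝ) with hq'
  have hq : 0 < q' := by rw [hq']; exact_mod_cast hs.card_pos
  have hq1 : 1 ≤ q' := by rw [hq']; exact_mod_cast hs.card_pos
  have hu1 : 1 / q' ≤ 1 := by rw [div_le_one hq]; exact hq1
  have hp1 : ∀ j ∈ s, p j ≤ 1 := fun j hj => by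
    rw [← hsum]; exact single_le_sum hp0 hj
  have key : ∀ j ∈ s, (1 / q') * log (1 / q') + (1 + log (1 / q')) * (p j - 1 / q') +
      (p j - 1 / q') ^ 2 / 2 ≤ p j * log (p j) :=
    fun j hj => mul_log_lower_quadratic (hp0 j hj) (hp1 j hj) (by positivity) hu1
  have hsumkey := sum_le_sum key
  rw [sum_add_distrib, sum_add_distrib, sum_const, ← mul_sum, sum_sub_distrib, hsum,
    sum_const, nsmul_eq_mul, nsmul_eq_mul, ← hq'] at hsumkey
  have h1 : q' * (1 / q' * log (1 / q')) = -log q' := by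
    rw [one_div, log_inv]; field_simp
  have h2 : (1 : ℝ) - q' * (1 / q') = 0 := by field_simp; ring
  rw [h1, h2, mul_zero, add_zero] at hsumkey
  have h3 : (p j₀ - 1 / q') ^ 2 / 2 ≤ ∑ j ∈ s, (p j - 1 / q') ^ 2 / 2 :=
    single_le_sum (f := fun j => (p j - 1 / q') ^ 2 / 2) (fun j _ => by positivity) hj₀
  linarith

/-! ### Rothvoß's Lemma 10, quantitative core -/

/-- **Rothvoß 2017, Lemma 10 (pseudo-random behaviour of large sets; after Razborov),
quantitative core.** Let `Y ⊆ X := Π_i X_i` be nonempty (`X_i` finite, `|X_i| ≤ q`), and call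
`i` *`ε`-biased* if some `j ∈ X_i` has `Pr_{y ∼ Y}[y_i = j]` outside
`[1/((1+ε)|X_i|), (1+ε)/|X_i|]` (written multiplied out below). Then for every set `B` of
`ε`-biased indices, `|B| · (ε/((1+ε)q))²/2 ≤ log |X| - log |Y|`. In particular
`|Y| ≥ 2^{-δm}|X|` forces `|B| ≤ (δ m log 2) / c`, the printed "at most `εm` indices are
`ε`-biased" for `δ` small. Proof as printed: `log |Y| ≤ Σ_i H(y_i)` (sub-additivity of entropy,
`y` uniform on `Y`) and `H(y_i) ≤ log |X_i| - c` at biased coordinates (`neg_sum_mul_log_le`).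
[cite: Rothvoss2017, Lemma 10 (PDF pp. 10–11)] -/
theorem card_biased_mul_le_log {ι β : Type*} [Fintype ι] [DecidableEq ι] [DecidableEq β]
    (X : ι → Finset β) (Y : Finset (ι → β)) (hY : Y ⊆ Fintype.piFinset X) (hYne : Y.Nonempty)
    {ε : ℝ} (hε : 0 < ε) {q : ℕ} (hq : ∀ i, (X i).card ≤ q) (B : Finset ι)
    (hB : ∀ i ∈ B, ∃ j ∈ X i,
      (1 + ε) * (X i).card * ((Y.filter fun y => y i = j).card : ℝ) < Y.card ∨
      (1 + ε) * (Y.card : ℝ) < (X i).card * ((Y.filter fun y => y i = j).card : ℝ)) :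
    (B.card : ℝ) * ((ε / ((1 + ε) * q)) ^ 2 / 2) ≤
      log (∏ i, ((X i).card : ℝ)) - log (Y.card : ℝ) := by
  classical
  set Yc : ℝ := (Y.card : ℝ) with hYc'
  have hYc : 0 < Yc := by rw [hYc']; exact_mod_cast hYne.card_pos
  have hmaps : ∀ i, ∀ y ∈ Y, y i ∈ X i := fun i y hy => Fintype.mem_piFinset.1 (hY hy) i
  have hXne : ∀ i, (X i).Nonempty := fun i => by
    obtain ⟨y, hy⟩ := hYne
    exact ⟨y i, hmaps i y hy⟩
  -- marginal counts and frequencies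
  set N : ι → β → ℝ := fun i j => ((Y.filter fun y => y i = j).card : ℝ) with hN
  set p : ι → β → ℝ := fun i j => N i j / Yc with hp
  have hNsum : ∀ i, ∑ j ∈ X i, N i j = Yc := by
    intro i
    have := sum_fiberwise_of_maps_to (s := Y) (t := X i) (g := fun y => y i) (hmaps i)
      (fun _ => (1 : ℝ))
    simp only [sum_const] at this
    simpa [hN, hYc'] using this
  have hpsum : ∀ i, ∑ j ∈ X i, p i j = 1 := by
    intro i
    simp only [hp]
    rw [← sum_div, hNsum, div_self hYc.ne']
  have hp0 : ∀ i j, 0 ≤ p i j := fun i j => by positivity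
  have hppos : ∀ y ∈ Y, ∀ i, 0 < p i (y i) := by
    intro y hy i
    have hmem : y ∈ Y.filter fun y' => y' i = y i := mem_filter.2 ⟨hy, rfl⟩
    have : (0 : ℝ) < N i (y i) := by
      simp only [hN]
      exact_mod_cast card_pos.2 ⟨y, hmem⟩
    exact div_pos this hYc
  -- Step A: sub-additivity of entropy, `log |Y| ≤ Σ_i H_i`
  have hA : log Yc ≤ ∑ i, -∑ j ∈ X i, p i j * log (p i j) := by
    have hHi : ∀ i, -∑ j ∈ X i, p i j * log (p i j) =
        -(1 / Yc) * ∑ y ∈ Y, log (p i (y i)) := by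
      intro i
      rw [neg_mul, mul_sum, ← sum_fiberwise_of_maps_to' (s := Y) (t := X i) (g := fun y => y i)
        (hmaps i) (fun j => 1 / Yc * log (p i j))]
      congr 1
      refine sum_congr rfl fun j _ => ?_
      rw [sum_const, nsmul_eq_mul]
      simp only [hp, hN]
      ring
    simp_rw [hHi]
    rw [← mul_sum, sum_comm]
    have hprod : ∀ y ∈ Y, (∑ i, log (p i (y i))) + log Yc = log (Yc * ∏ i, p i (y i)) := by
      intro y hy
      rw [log_mul hYc.ne' (prod_ne_zero_iff.2 fun i _ => (hppos y hy i).ne'),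
        log_prod fun i _ => (hppos y hy i).ne']
      ring
    have hle : ∀ y ∈ Y, log (Yc * ∏ i, p i (y i)) ≤ Yc * ∏ i, p i (y i) - 1 := fun y hy =>
      log_le_sub_one_of_pos (mul_pos hYc (prod_pos fun i _ => hppos y hy i))
    have htotal : ∑ y ∈ Y, Yc * ∏ i, p i (y i) ≤ Yc := by
      rw [← mul_sum]
      have h1 : ∑ y ∈ Y, ∏ i, p i (y i) ≤ ∑ y ∈ Fintype.piFinset X, ∏ i, p i (y i) :=
        sum_le_sum_of_subset_of_nonneg hY fun y _ _ => prod_nonneg fun i _ => hp0 i (y i)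
      rw [← prod_univ_sum] at h1
      simp only [hpsum, prod_const_one] at h1
      nlinarith
    have hsum_le : ∑ y ∈ Y, ((∑ i, log (p i (y i))) + log Yc) ≤ 0 := by
      calc ∑ y ∈ Y, ((∑ i, log (p i (y i))) + log Yc)
          = ∑ y ∈ Y, log (Yc * ∏ i, p i (y i)) := sum_congr rfl hprod
        _ ≤ ∑ y ∈ Y, (Yc * ∏ i, p i (y i) - 1) := sum_le_sum hle
        _ = (∑ y ∈ Y, Yc * ∏ i, p i (y i)) - Yc := by
            rw [sum_sub_distrib, sum_const, nsmul_eq_mul, mul_one]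
        _ ≤ 0 := by linarith
    rw [sum_add_distrib, sum_const, nsmul_eq_mul, ← hYc'] at hsum_le
    rw [show -(1 / Yc) * ∑ y ∈ Y, ∑ i, log (p i (y i)) =
        (-(∑ y ∈ Y, ∑ i, log (p i (y i)))) / Yc by ring, le_div_iff₀ hYc]
    linarith
  -- Step B: entropy deficit at biased coordinates
  set c : ℝ := (ε / ((1 + ε) * q)) ^ 2 / 2 with hc
  have hB' : ∀ i, -∑ j ∈ X i, p i j * log (p i j) ≤
      log ((X i).card : ℝ) - (if i ∈ B then c else 0) := by
    intro i
    have hxpos : (0 : ℝ) < (X i).card := by exact_mod_cast (hXne i).card_pos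
    have hx1 : (1 : ℝ) ≤ (X i).card := by exact_mod_cast (hXne i).card_pos
    have hxq : ((X i).card : ℝ) ≤ q := by exact_mod_cast hq i
    split_ifs with hi
    · obtain ⟨j₀, hj₀, hbias⟩ := hB i hi
      have h1 := neg_sum_mul_log_le (hXne i) (p i) (fun j _ => hp0 i j) (hpsum i) hj₀
      -- the deviation of `p i j₀` from `1 / |X i|`
      set x : ℝ := ((X i).card : ℝ) with hx
      have hqpos : (0 : ℝ) < q := lt_of_lt_of_le hxpos hxq
      have hdev : ε / ((1 + ε) * q) ≤ |p i j₀ - 1 / x| := by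
        have hstep : ε / ((1 + ε) * q) ≤ ε / ((1 + ε) * x) :=
          div_le_div_of_nonneg_left hε.le (by positivity) (by nlinarith)
        refine hstep.trans ?_
        rcases hbias with h | h
        · -- `p < 1 / ((1+ε) x)`
          have hp' : p i j₀ * ((1 + ε) * x) < 1 := by
            simp only [hp]
            rw [div_mul_eq_mul_div, div_lt_one hYc]
            linarith
          have hlt : p i j₀ < 1 / ((1 + ε) * x) := by
            rw [lt_div_iff₀ (by positivity)]; exact hp'
          have hgap : 1 / x - 1 / ((1 + ε) * x) = ε / ((1 + ε) * x) := by
            field_simp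
            ring
          rw [abs_sub_comm, abs_of_nonneg (by rw [sub_nonneg]; exact hlt.le.trans (by
            rw [div_le_div_iff₀ (by positivity) hxpos]; nlinarith))]
          linarith
        · -- `p > (1+ε) / x`
          have hp' : 1 + ε < p i j₀ * x := by
            simp only [hp]
            rw [div_mul_eq_mul_div, lt_div_iff₀ hYc]
            linarith
          have hgt : (1 + ε) / x < p i j₀ := by
            rw [div_lt_iff₀ hxpos]; exact hp'
          have hgap : (1 + ε) / x - 1 / x = ε / x := by
            field_simp
            ring
          have hεx : ε / ((1 + ε) * x) ≤ ε / x :=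
            div_le_div_of_nonneg_left hε.le hxpos (by nlinarith)
          rw [abs_of_nonneg (by linarith [hgt, hεx, hgap, show 0 ≤ ε / ((1 + ε) * x) by positivity])]
          linarith
      have hsq : (ε / ((1 + ε) * q)) ^ 2 ≤ (p i j₀ - 1 / x) ^ 2 := by
        rw [← sq_abs (p i j₀ - 1 / x)]
        exact pow_le_pow_left₀ (by positivity) hdev 2
      simp only [hc]
      linarith
    · obtain ⟨j₀, hj₀⟩ := hXne i
      have h1 := neg_sum_mul_log_le (hXne i) (p i) (fun j _ => hp0 i j) (hpsum i) hj₀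
      linarith [sq_nonneg (p i j₀ - 1 / (X i).card)]
  -- Sum Step B over the coordinates and combine with Step A
  have hBsum := sum_le_sum fun i (_ : i ∈ (univ : Finset ι)) => hB' i
  rw [sum_sub_distrib] at hBsum
  have hite : ∑ i, (if i ∈ B then c else (0 : ℝ)) = B.card * c := by
    rw [← sum_filter, Finset.filter_mem_eq_inter, Finset.univ_inter, sum_const, nsmul_eq_mul]
  have hlogprod : ∑ i, log ((X i).card : ℝ) = log (∏ i, ((X i).card : ℝ)) :=
    (log_prod fun i _ => (by
      have : (0 : ℝ) < (X i).card := by exact_mod_cast (hXne i).card_pos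
      exact this.ne')).symm
  rw [hite, hlogprod] at hBsum
  linarith [hA, hBsum]

end Literature.Barriers.PneNP

end
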